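import Summits.ResolutionOfSingularities.ResolutionOfSingularities.Theorems.FrobeniusLadderFInjectiveMacaulayficationDominatingLocFixLocal
import Summits.ResolutionOfSingularities.ResolutionOfSingularities.Theorems.FrobeniusLadderFInjectiveMacaulayficationRegularBlowupModelGeneral
import Summits.ResolutionOfSingularities.ResolutionOfSingularities.Theorems.FrobeniusLadderFInjectiveMacaulayficationGenericFibreModel
import Literature.AlgebraicGeometry.Resolution.BlowupsProduct
import HarnessLib

/-!
# The product-compatible REGULAR local fix at a point of local dimension `≤ 2` (Lipman) — the dimension gap of R16.43 (b) closed
# (crux `FInjectiveMacaulayfication` stmt-ResolutionOfSingularities-15315, chain w45a; res-L1-w45a-plan-1 R16.46 (4) / R16.49 «stub-1 … → dim ≤ 2 gap»;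
# seat res-L1-w45a-stub-1 g6)

[OURS · L1 W4.5a] Support file (`--supports stmt-ResolutionOfSingularities-15315 --as helper`); NOT a statement of any manuscript; def-free;
THEOREMS modulo Lipman 1978 (`Lipman1978SequenceFinite`) BY NAME; AI-written (AI review is weaker than expert review).

THE TRICK (which needs NO principalization theorem): to cure COMPATIBLY with a given `J ≠ ⊥`, FIRST blow up `J` itself (`π₀ : X₀′ = Bl_J X₀ → X₀`;
`J𝒪_{X₀′}` is Cartier by definition), THEN take a regular blowing-up model `π′ : Y → X₀′` of the variety `X₀′` (dimension `≤ 2`: Lipman's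
tower made into one blowing up, res-L1-w45a-lead-1's `RegularBlowupModelGeneral.exists_regular_isBlowup_of_lipman`); the composite `Y → X₀`
is one blowing up along some `Q` (Stacks 080B) and — `J𝒪_Y` being Cartier (pull-back of a Cartier divisor under a blowing up, Stacks 0809
`IsEffectiveCartier.comap_of_isBlowup`) — also THE blowing up along `J · Q` (Stacks 080A with the identity blowing up); `Q ≠ ⊥` because a
non-empty scheme is not a blowing up along `⊥`.

* `not_isEffectiveCartier_bot` — on a scheme with a point, `⊥` is not an effective Cartier divisor.
* `exists_isBlowup_mul_isRegular_of_dim_le_two (hL)` — for an integral separated `K`-variety `X₀` of dimension `≤ 2` and ANY `J ≠ ⊥`: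
  `∃ 𝔟 ≠ ⊥`, a blowing up along `J · 𝔟` exists and is regular, and every blowing up along `J · 𝔟` is regular.
* `exists_productCompatible_locFix_dimLe2 (hL)` — at a point `ζ` with `dim 𝒪_{X₁,ζ} ≤ 2` of an integral `k`-scheme locally of finite type
  with Cohen–Macaulay stalks and for `J₀ ≠ ⊥`: germs `c`, `(c) ≠ ⊥`, and generators `d` of `J₀,ζ · (c)` with ALL affine blow-up charts
  `𝒪_ζ[(d)/d_j]` REGULAR and FULL at every prime. Via the generic-fibre model (`GenericFibreModel.exists_model_closedPoint`: a `K₀`-variety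
  `X₀` with a closed point `b` and `𝒪_{X₀,b} ≅ 𝒪_{X₁,ζ}`, `dim X₀ = dim 𝒪_ζ ≤ 2`), the scheme-level theorem on `X₀` for the spread of
  `J₀,ζ`, the general-prime chart–point dictionary `LocFixFullAtNonClosedLowDim.exists_point_of_blowupAlgebra_prime_any`, and transport of
  the charts along `𝒪_{X₀,b} ≅ 𝒪_ζ` (`PointFixableTransport.exists_blowupAlgebra_congr'`).
With `DominatingLocFixLocal.exists_productCompatible_locFix_dimThree` (CP 2019) this covers every residual point of local dimension `≤ 3`,
i.e. every non-closed point of a fourfold.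
[cite: Liu2002, Thm. 8.3.44 (PDF p. 427)] [cite: StacksProject, Tag 080A; Tag 080B; Tag 0809; Tag 0804] [cite: Matsumura1987, Thm. 17.4]
-/

-- single-problem summit: the doubled namespace component is forced
set_option linter.dupNamespace false

noncomputable section

namespace Summit.ResolutionOfSingularities.ResolutionOfSingularities.Theorems.FInjectiveMacaulayfication.DominatingLocFixLocalDimLe2

open CategoryTheory CategoryTheory.Limits AlgebraicGeometry TopologicalSpace IsLocalRing
open Literature.AlgebraicGeometry.Resolution
open Summit.ResolutionOfSingularities.ResolutionOfSingularities.Theorems.FInjectiveMacaulayfication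
open SliceableCentre FCUnguardedAprime
open Scheme.IdealSheafData

/-! ## §1 Scheme level: the product-compatible regular blowing-up model of a surface (Lipman) -/

/-- On a scheme with a point, the zero ideal sheaf is not an effective Cartier divisor (its local equation would be the zero-divisor `0`).
[folklore] -/
theorem not_isEffectiveCartier_bot {X : Scheme.{0}} (x : X) : ¬ IsEffectiveCartier (⊥ : X.IdealSheafData) := by
  intro h
  obtain ⟨U, hxU, f, hf, hU⟩ := h x
  rw [Scheme.IdealSheafData.ideal_bot, Pi.bot_apply] at hU
  have hf0 : f = 0 := by
    have hmem : f ∈ (⊥ : Ideal Γ(X, U)) := by rw [hU]; exact Ideal.mem_span_singleton_self f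
    simpa using hmem
  rw [hf0] at hf
  haveI : Nontrivial Γ(X, U) := (X.presheaf.germ U x hxU).hom.domain_nontrivial
  exact zero_notMem_nonZeroDivisors hf

/-- **Product-compatible regular blowing-up model of a variety of dimension `≤ 2`** (modulo Lipman 1978 BY NAME): for an integral separated
`K`-scheme `X₀` of finite type with `dim X₀ ≤ 2` and ANY ideal sheaf `J ≠ ⊥` there is `𝔟 ≠ ⊥` such that a blowing up along `J · 𝔟` exists and is
regular, and every blowing up along `J · 𝔟` is regular. First blow up `J`, then take the regular blowing-up model of `Bl_J X₀`.
[OURS · conditional-result] [cite: Liu2002, Thm. 8.3.44 (PDF p. 427)] [cite: StacksProject, Tag 080A; Tag 080B; Tag 0809] -/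
theorem exists_isBlowup_mul_isRegular_of_dim_le_two (hL : Lipman1978SequenceFinite.{0}) {K : Type} [Field K]
    (X₀ : Scheme.{0}) (f₀ : X₀ ⟶ Spec (.of K)) [IsSeparated f₀] [LocallyOfFiniteType f₀] [QuasiCompact f₀] [IsIntegral X₀]
    (hdim : topologicalKrullDim X₀ ≤ 2) (J : X₀.IdealSheafData) (hJ : J ≠ ⊥) :
    ∃ 𝔟 : X₀.IdealSheafData, 𝔟 ≠ ⊥ ∧ (∃ (T : Scheme.{0}) (π : T ⟶ X₀), IsBlowup π (J * 𝔟) ∧ Scheme.IsRegular T) ∧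
      ∀ (T : Scheme.{0}) (π : T ⟶ X₀), IsBlowup π (J * 𝔟) → Scheme.IsRegular T := by
  classical
  haveI : IsLocallyNoetherian X₀ := LocallyOfFiniteType.isLocallyNoetherian f₀
  haveI : CompactSpace X₀ := QuasiCompact.compactSpace_of_compactSpace f₀
  haveI : IsNoetherian X₀ := ⟨⟩
  -- (1) blow up `J` itself
  obtain ⟨X₀', π₀, hπ₀⟩ := exists_isBlowup X₀ J
  haveI : IsProper π₀ := hπ₀.isProper
  haveI : IsIntegral X₀' := hπ₀.isIntegral hJ
  have hdim' : topologicalKrullDim X₀' ≤ 2 := by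
    rw [(hπ₀.isBirational' hJ).topologicalKrullDim_eq_of_isProper]
    exact hdim
  -- (2) the regular blowing-up model of the variety `X₀′` (Lipman)
  obtain ⟨Y, -, π', J', hJ', hπ', hYreg⟩ := RegularBlowupModelGeneral.exists_regular_isBlowup_of_lipman hL X₀' (π₀ ≫ f₀) hdim'
  haveI : IsLocallyNoetherian X₀' := LocallyOfFiniteType.isLocallyNoetherian π₀
  haveI : IsIntegral Y := hπ'.isIntegral hJ'
  -- (3) the composite is one blowing up along some `Q`, and `J𝒪_Y` is Cartier
  obtain ⟨Q, hQ, -⟩ := hπ₀.exists_isBlowup_comp hπ'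
  have hcart : IsEffectiveCartier (J.comap (π' ≫ π₀)) := by
    rw [comap_comp]
    exact IsEffectiveCartier.comap_of_isBlowup hπ' hπ₀.isEffectiveCartier
  have hfin : IsBlowup (π' ≫ π₀) (J * Q) := by
    have h := hQ.comp (IsBlowup.id hcart)
    rw [Category.id_comp, mul_comm] at h
    exact h
  -- `Q ≠ ⊥`: else `Y` (non-empty) would be a blowing up along `⊥`
  have hQ0 : Q ≠ ⊥ := by
    intro h0
    rw [h0, mul_bot] at hfin
    have h1 := hfin.isEffectiveCartier
    rw [Scheme.IdealSheafData.comap_bot] at h1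
    obtain ⟨y⟩ := (inferInstance : Nonempty Y)
    exact not_isEffectiveCartier_bot y h1
  refine ⟨Q, hQ0, ⟨Y, π' ≫ π₀, hfin, hYreg⟩, fun T'' π'' hπ'' => ?_⟩
  obtain ⟨e, -, -⟩ := hfin.unique hπ''
  exact hYreg.of_iso e.hom

/-! ## §2 At a point `ζ` of local dimension `≤ 2`: the regular product-compatible charts -/

set_option maxHeartbeats 800000 in
-- the chart transport along `𝒪_{X₀,b} ≅ 𝒪_ζ` and the chart–point dictionary elaborate large terms
/-- **(b) at local dimension `≤ 2`.** For `J₀ ≠ ⊥` and `ζ ∈ X₁` with `dim 𝒪_{X₁,ζ} ≤ 2` (`X₁` integral, locally of finite type over `k`,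
Cohen–Macaulay stalks) there are germs `c` with `(c) ≠ ⊥` and generators `d` of `J₀,ζ · (c)` all of whose affine blow-up charts `𝒪_ζ[(d)/d_j]`
are REGULAR and FULL at EVERY prime — modulo Lipman 1978 BY NAME. [OURS · conditional-result]
[cite: Liu2002, Thm. 8.3.44 (PDF p. 427)] [cite: StacksProject, Tag 0804] [cite: Matsumura1987, Thm. 17.4] -/
theorem exists_productCompatible_locFix_dimLe2 (hL : Lipman1978SequenceFinite.{0})
    (p : ℕ) [hp : Fact p.Prime] {k : Type} [Field k] [CharP k p] {X₁ : Scheme.{0}} (f₁ : X₁ ⟶ Spec (.of k))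
    [LocallyOfFiniteType f₁] [IsIntegral X₁] (hCM : ∀ x : X₁, CMCl (X₁.presheaf.stalk x))
    (ζ : X₁) (hdim : ringKrullDim (X₁.presheaf.stalk ζ) ≤ 2) (J₀ : X₁.IdealSheafData) (hJ₀ : J₀ ≠ ⊥) :
    ∃ (m : ℕ) (c : Fin m → X₁.presheaf.stalk ζ) (n : ℕ) (d : Fin n → X₁.presheaf.stalk ζ),
      Ideal.span (Set.range c) ≠ ⊥ ∧ Ideal.span (Set.range d) = stalkIdeal J₀ ζ * Ideal.span (Set.range c) ∧
      ∀ (j : Fin n) (𝔔 : PrimeSpectrum (blowupAlgebra (Ideal.span (Set.range d)) (d j))),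
        IsRegularLocalRing (Localization.AtPrime 𝔔.asIdeal) ∧ FullCl p (Localization.AtPrime 𝔔.asIdeal) := by
  classical
  haveI : IsLocallyNoetherian X₁ := LocallyOfFiniteType.isLocallyNoetherian f₁
  -- (1) the generic-fibre model: a `K₀`-variety `X₀` with a closed point `b` and `e : 𝒪_{X₀,b} ≅ 𝒪_ζ`
  obtain ⟨K₀, _, _, X₀, f₀, hs₀, hft₀, hqc₀, hint₀, -, b, hbcl, ⟨e⟩⟩ :=
    GenericFibreModel.exists_model_closedPoint p hp.out k X₁ f₁ inferInstance inferInstance hCM ζ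
  haveI := hs₀
  haveI := hft₀
  haveI := hqc₀
  haveI := hint₀
  haveI : IsLocallyNoetherian X₀ := LocallyOfFiniteType.isLocallyNoetherian f₀
  haveI : CompactSpace X₀ := QuasiCompact.compactSpace_of_compactSpace f₀
  haveI : IsNoetherian X₀ := ⟨⟩
  have hdim₀ : topologicalKrullDim X₀ ≤ 2 := by
    rw [WFixAtNonClosedDimTwo.topologicalKrullDim_eq_ringKrullDim_stalk_of_isClosed f₀ hbcl, ringKrullDim_eq_of_ringEquiv e]
    exact hdim
  -- (2) `J₀,ζ` read in `𝒪_{X₀,b}` and spread to an ideal sheaf `J̃` on `X₀`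
  set I₀ : Ideal (X₀.presheaf.stalk b) := (stalkIdeal J₀ ζ).comap e.toRingHom with hI₀def
  have hI₀map : I₀.map e.toRingHom = stalkIdeal J₀ ζ := Ideal.map_comap_of_surjective _ e.surjective _
  have hI₀ : I₀ ≠ ⊥ := by
    intro h0
    apply stalkIdeal_ne_bot_of_ne_bot hJ₀ ζ
    rw [← hI₀map, h0, Ideal.map_bot]
  obtain ⟨Jt, hJt, hJtb⟩ : ∃ Jt : X₀.IdealSheafData, Jt ≠ ⊥ ∧ stalkIdeal Jt b = I₀ := by
    by_cases htop : I₀ = ⊤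
    · refine ⟨⊤, fun h => ?_, by rw [stalkIdeal_top, htop]⟩
      have h1 : stalkIdeal (⊤ : X₀.IdealSheafData) b = stalkIdeal (⊥ : X₀.IdealSheafData) b := by rw [h]
      rw [stalkIdeal_top, stalkIdeal_bot] at h1
      have h2 : (1 : X₀.presheaf.stalk b) ∈ (⊥ : Ideal (X₀.presheaf.stalk b)) := h1 ▸ Submodule.mem_top
      exact one_ne_zero ((Submodule.mem_bot _).mp h2)
    · obtain ⟨m₀, g, hg⟩ := Submodule.fg_iff_exists_fin_generating_family.mp (IsNoetherian.noetherian I₀)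
      have hg' : Ideal.span (Set.range g) = I₀ := hg
      obtain ⟨Jt, hJt, -, hJtb⟩ := CentreSpread.centreSpread X₀ b m₀ g (by rw [hg']; exact hI₀) (by rw [hg']; exact le_maximalIdeal htop)
      exact ⟨Jt, hJt, by rw [hJtb, hg']⟩
  -- (3) the product-compatible regular blowing-up model on `X₀`
  obtain ⟨𝔟, h𝔟, -, hall⟩ := exists_isBlowup_mul_isRegular_of_dim_le_two hL X₀ f₀ hdim₀ Jt hJt
  obtain ⟨Y, π, hπ⟩ := exists_isBlowup X₀ (Jt * 𝔟)
  have hYreg : Scheme.IsRegular Y := hall Y π hπ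
  -- (4) generators at `b`: `c₀` of `𝔟_b`, `d₀` of `J₀,ζ · 𝔟_b = (J̃ · 𝔟)_b`
  have h𝔮0 : stalkIdeal 𝔟 b ≠ ⊥ := stalkIdeal_ne_bot_of_ne_bot h𝔟 b
  obtain ⟨m, c₀, hc₀⟩ := Submodule.fg_iff_exists_fin_generating_family.mp (IsNoetherian.noetherian (stalkIdeal 𝔟 b))
  obtain ⟨n, d₀, hd₀⟩ := Submodule.fg_iff_exists_fin_generating_family.mp (IsNoetherian.noetherian (I₀ * stalkIdeal 𝔟 b))
  have hc₀' : Ideal.span (Set.range c₀) = stalkIdeal 𝔟 b := hc₀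
  have hd₀' : Ideal.span (Set.range d₀) = I₀ * stalkIdeal 𝔟 b := hd₀
  have hd₀'' : Ideal.span (Set.range d₀) = stalkIdeal (Jt * 𝔟) b := by rw [stalkIdeal_mul, hJtb, hd₀']
  -- (5) transport along `e`
  have hcmap : Ideal.span (Set.range fun i : Fin m => e (c₀ i)) = Ideal.map e (Ideal.span (Set.range c₀)) :=
    PointFixableTransport.span_range_comp e c₀
  have hdmap : Ideal.span (Set.range fun j : Fin n => e (d₀ j)) = Ideal.map e (Ideal.span (Set.range d₀)) :=
    PointFixableTransport.span_range_comp e d₀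
  refine ⟨m, fun i => e (c₀ i), n, fun j => e (d₀ j), ?_, ?_, fun j 𝔔' => ?_⟩
  · rw [hcmap]
    exact fun h0 => (by rw [hc₀'] at h0; exact h𝔮0 ((Ideal.map_eq_bot_iff_of_injective e.injective).mp h0))
  · rw [hdmap, hcmap, hd₀', Ideal.map_mul, hc₀']
    congr 1
  · -- the chart prime `𝔔′` over `𝒪_ζ` ↦ `𝔔` over `𝒪_{X₀,b}` ↦ a point `y′` of the regular `Y`
    obtain ⟨E, hE⟩ := PointFixableTransport.exists_blowupAlgebra_congr' e (Ideal.span (Set.range d₀)) (d₀ j) _ _ hdmap rfl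
    let 𝔔 : PrimeSpectrum (blowupAlgebra (Ideal.span (Set.range d₀)) (d₀ j)) := ⟨𝔔'.asIdeal.comap E.toRingHom, Ideal.comap_isPrime _ _⟩
    haveI := 𝔔.isPrime
    haveI := 𝔔'.isPrime
    obtain ⟨eL⟩ := BlowupFiModelOfCover.nonempty_ringEquiv_localization_of_ringEquiv E 𝔔.asIdeal 𝔔'.asIdeal (fun x => Iff.rfl)
    obtain ⟨y', -, ⟨e1⟩⟩ := LocFixFullAtNonClosedLowDim.exists_point_of_blowupAlgebra_prime_any hπ b d₀ hd₀'' j 𝔔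
    have hreg : IsRegularLocalRing (Localization.AtPrime 𝔔'.asIdeal) := by
      haveI : IsRegularLocalRing (Y.presheaf.stalk y') := hYreg y'
      exact IsRegularLocalRing.of_ringEquiv (e1.trans eL)
    haveI : CharP (Localization.AtPrime 𝔔'.asIdeal) p :=
      CharP.of_ringHom_of_ne_zero
        ((algebraMap (blowupAlgebra (Ideal.span (Set.range fun j : Fin n => e (d₀ j))) (e (d₀ j))) (Localization.AtPrime 𝔔'.asIdeal)).comp
          ((algebraMap (X₁.presheaf.stalk ζ) (blowupAlgebra (Ideal.span (Set.range fun j : Fin n => e (d₀ j))) (e (d₀ j)))).comp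
            ((X₁.presheaf.germ ⊤ ζ trivial).hom.comp (f₁.appTop.hom.comp (Scheme.ΓSpecIso (.of k)).inv.hom))))
        p hp.out.ne_zero
    haveI := hreg
    exact ⟨hreg, FiClauseOfRegular.stub_fiClauseOfRegular p _⟩

end Summit.ResolutionOfSingularities.ResolutionOfSingularities.Theorems.FInjectiveMacaulayfication.DominatingLocFixLocalDimLe2

end
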